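import Mathlib
import HarnessLib
import Summits.AtomisticToContinuum.FouriersLaw.Theses.JunctionLocality
import Literature.MathematicalPhysics.KineticTheory.LangevinChainGibbs
import Summits.AtomisticToContinuum.FouriersLaw.Theorems.JunctionLocalitySuperadditiveResistanceStubInsertionIdentity
import Summits.AtomisticToContinuum.FouriersLaw.Theorems.JunctionLocalityInsertionCore

/-!
# Line `thermalise-then-cut-probe-insertion` (crux `JunctionLocality.SuperadditiveResistance`,
stmt-AtomisticToContinuum-11748) — the equilibrium KUBO FRAME of the γ-probed junction device (skeleton v3)

Lead prover-line-stmt-AtomisticToContinuum-11748-0, 2026-08-16. The line's device (the `(N+M)`-chain of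
`pinnedChain ω₂ lam β γ` with two extra friction-`γ` Langevin thermostats on the junction momenta `p_{N−1}, p_N`,
bond kept; vocabulary `kin`, `deviceGenerator`, `IsForwardField`, `PlainFrame`, `DeviceFrame`, … of
`Theorems/JunctionLocalitySuperadditiveResistanceStubInsertionIdentity.lean`) entered the v1/v2 skeleton through
`DeviceFrame`, whose clauses (i) existence of device steady states, (ii) their uniqueness and (v) "`g` is the linear
response of the four bath powers along every device family" are consumed by NO step of the line: the composition
`SuperadditiveResistance_of` uses the symmetric PSD matrix `g`, and the insertion engine
`InsertionToolbox.Assembly.insertion_core` (Theorems/JunctionLocalityInsertionCore.lean, the content of the landed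
`stub_insertionIdentity`) uses the two END-bath forward fields with their pointwise Poisson equations and the Kubo rows of
baths 1 and 4. `KuboFrame` is exactly that sub-conjunction, so that the fixed-`N` obligation of the line becomes
"forward fields exist + Onsager symmetry + non-negative Kubo entropy form" instead of "network CEHR existence + device
NessUnique + device Kubo response" (wave-1 verdict on `stub_linearResponse`). Contents: `KuboFrame` (def),
`kuboFrame_of_deviceFrame` (v3 only weakens the frame), `insertionIdentity_of_kuboFrame` (the landed identity re-wrapped,
sorry-free). Physically `g` is the device's four-terminal response matrix (finite-volume Kubo formula, Rey-Bellet 2003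
Rem. 4.4; Kundu–Dhar–Narayan 2009) — an identification this line no longer needs to prove.
-/

noncomputable section

open MeasureTheory Filter Topology ProbabilityTheory
open scoped ContDiff NNReal
open Literature.MathematicalPhysics.KineticTheory.HeatConduction

namespace Summit.AtomisticToContinuum.FouriersLaw.Cruxes.SuperadditiveResistance.ThermaliseThenCutProbeInsertion

/-! ## The equilibrium Kubo frame (v3) -/

/-- KUBO FRAME for the split `(N, M)` at temperature `T` (v3 replacement of `DeviceFrame`): `g` is a symmetric matrix
of transfer conductances with non-negative entropy-production form whose rows `0` and `3` ARE the Kubo rows of the two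
END-bath forward fields `gb₁ = (−L_dev)⁻¹(p_0² − T)`, `gb₄ = (−L_dev)⁻¹(p²_{N+M−1} − T)` of the equilibrium device
(`IsForwardField`: `C²` classical solutions, mean zero, `gb` and `S_K gb` in `L²(μ_T)`; unique by
`DeviceLiouville.forwardField_unique`): `g_{0b} = (γ²/T²)⟨gb₁, p²_{s_b} − T⟩` (`b ≠ 0`),
`L₁₁ = selfLeft g = γ − (γ²/T²)⟨gb₁, p_0² − T⟩`, and likewise at bath 4. Exactly the clauses (iii), (iv), (vi), (viii),
(x)–(xiii) of `DeviceFrame`; no device steady state, no device uniqueness, no response limit. -/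
def KuboFrame (P : OscillatorChain) (T : ℝ) (N M : ℕ) (g : Fin 4 → Fin 4 → ℝ)
    (gb₁ gb₄ : PhaseSpace (N + M) → ℝ) : Prop :=
  (∀ a b, g a b = g b a) ∧
  (∀ θ, 0 ≤ dirichletForm g θ) ∧
  IsForwardField P T N M 0 gb₁ ∧
  IsForwardField P T N M (N + M - 1) gb₄ ∧
  (∀ b : Fin 4, b ≠ 0 → g 0 b = P.γ ^ 2 / T ^ 2 *
      ∫ x, gb₁ x * (kin (N + M) (termSite N M b) x - T) ∂(P.gibbsMeasure (N + M) T)) ∧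
  selfLeft g = P.γ - P.γ ^ 2 / T ^ 2 *
      ∫ x, gb₁ x * (kin (N + M) 0 x - T) ∂(P.gibbsMeasure (N + M) T) ∧
  (∀ b : Fin 4, b ≠ 3 → g 3 b = P.γ ^ 2 / T ^ 2 *
      ∫ x, gb₄ x * (kin (N + M) (termSite N M b) x - T) ∂(P.gibbsMeasure (N + M) T)) ∧
  selfRight g = P.γ - P.γ ^ 2 / T ^ 2 *
      ∫ x, gb₄ x * (kin (N + M) (N + M - 1) x - T) ∂(P.gibbsMeasure (N + M) T)

/-- v3 only WEAKENS the frame: every `DeviceFrame` is a `KuboFrame` (projection onto the clauses the line uses). -/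
theorem kuboFrame_of_deviceFrame {P : OscillatorChain} {T : ℝ} {N M : ℕ} {g : Fin 4 → Fin 4 → ℝ}
    {gb₁ gb₄ : PhaseSpace (N + M) → ℝ} (h : DeviceFrame P T N M g gb₁ gb₄) : KuboFrame P T N M g gb₁ gb₄ := by
  obtain ⟨-, -, hsym, hpsd, -, hgb₁, -, hgb₄, -, hK1, hself1, hK4, hself4⟩ := h
  exact ⟨hsym, hpsd, hgb₁, hgb₄, hK1, hself1, hK4, hself4⟩

/-- THE INSERTION IDENTITY OVER THE KUBO FRAME (v3 form of the landed `stub_insertionIdentity`, p90116): for every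
common first-order probe temperature `θ`, `(𝒢₁(θ) − G)² ≤ γ⁴ ‖S_K gb₁‖² v_K(h − θe_K)` and
`(𝒢₄(θ) − G)² ≤ γ⁴ ‖S_K gb₄‖² v_K(h − θe_K)`. Proof: the landed engine
`InsertionToolbox.Assembly.insertion_core` consumes exactly the Kubo-frame clauses (and only `h ∈ L²` + the weak
equation + the `G`-formula from `PlainFrame`). -/
theorem insertionIdentity_of_kuboFrame :
    ∀ (ω₂ lam β γ T : ℝ), 0 < ω₂ → 0 < lam → 0 < β → 0 < γ → 0 < T →
      ∀ (N M : ℕ), 2 ≤ N → 2 ≤ M →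
      ∀ (h : PhaseSpace (N + M) → ℝ) (G : ℝ) (g : Fin 4 → Fin 4 → ℝ)
        (gb₁ gb₄ : PhaseSpace (N + M) → ℝ),
        PlainFrame (pinnedChain ω₂ lam β γ) T (N + M) h G →
        KuboFrame (pinnedChain ω₂ lam β γ) T N M g gb₁ gb₄ →
        ∀ θ : ℝ,
          (sideOne g θ - G) ^ 2 ≤ γ ^ 4 * curvature (pinnedChain ω₂ lam β γ) T N M gb₁ *
              roughness (pinnedChain ω₂ lam β γ) T N M (fun x => h x - θ * eK T N M x) ∧
          (sideFour g θ - G) ^ 2 ≤ γ ^ 4 * curvature (pinnedChain ω₂ lam β γ) T N M gb₄ *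
              roughness (pinnedChain ω₂ lam β γ) T N M (fun x => h x - θ * eK T N M x) := by
  intro ω₂ lam β γ T hω hlam hβ hγ hT N M hN hM h G g gb₁ gb₄ hPF hKF θ
  obtain ⟨⟨hhL2, -, hweak⟩, -, hG⟩ := hPF
  obtain ⟨hsym, -, hgb₁, hgb₄, hKubo1, hself1, hKubo4, hself4⟩ := hKF
  obtain ⟨h1C2, h1L2, h1SL2, -, h1dev⟩ := hgb₁
  obtain ⟨h4C2, h4L2, h4SL2, -, h4dev⟩ := hgb₄
  exact InsertionToolbox.Assembly.insertion_core hω hlam hβ hγ hT hN hM h G g gb₁ gb₄ θ hhL2 hweak hG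
    hsym h1C2 h1L2 h1SL2 h1dev h4C2 h4L2 h4SL2 h4dev (hKubo1 1 (by decide)) (hKubo1 2 (by decide))
    (hKubo1 3 (by decide)) hself1 (hKubo4 0 (by decide)) (hKubo4 1 (by decide))
    (hKubo4 2 (by decide)) hself4


end Summit.AtomisticToContinuum.FouriersLaw.Cruxes.SuperadditiveResistance.ThermaliseThenCutProbeInsertion

end
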